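import Summits.CriticalPhenomena.CardyFormulaZ2.Theorems.CardyFlipRussoVoronoiHubFromSmirnovUnionLaw
import Literature.Analysis.FunctionSpaces.PoissonRestrictionIndependence
import Mathlib.Probability.Independence.Basic
import HarnessLib

/-!
# Events localised on disjoint regions are independent under the two-colour law `lawBW`
# (helper of crux `VoronoiHubFromSmirnov`, stmt-CriticalPhenomena-6433, line `moebius-exact-delaunay-dilation-ward`)

For the two-colour law `lawBW μ = poissonLaw μ ⊗ poissonLaw μ` (independent black and white nuclei
of the same locally finite atomless intensity `μ` on `ℂ`) and pairwise disjoint measurable regions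
`D i`, `i : Fin n`, the events `{c | (c.1 ∩ D i, c.2 ∩ D i) ∈ A i}` depending only on the coloured
configuration inside `D i` are mutually independent: their joint probability is the product of the
individual ones (`lawBW_iInter_restrict_eq_prod`).  This is the product rule used by the
"defect telescoping + one-arm" route (probabilities of events localised on DISJOINT regions of the
plane multiply).

Proof: `poissonLaw μ` is a Poisson process (`isPoissonPointProcess_poissonLaw_of_atomless`), so its
restrictions to the `D i` are independent (Kingman's Restriction Theorem, independence half:
`IsPoissonPointProcess.iIndepFun_restrict`, PROVED in tree); two independent families living on the
two factors of a product probability space zip to an independent family of pairs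
(`iIndepFun_prodMk_prod_of_measurable`, general measurable targets: rectangles
`X⁻¹ A ×ˢ Y⁻¹ B` form generating π-systems on which the product formula is
`Measure.prod_prod` + the two product formulas); conclude with
`ProbabilityTheory.iIndepFun.measure_inter_preimage_eq_mul` over `Finset.univ`.

References: J. F. C. Kingman, *Poisson Processes* (1993), §2.2 (Restriction Theorem).  No new
definitions.
-/

noncomputable section

namespace Summit.CriticalPhenomena.CardyFormulaZ2.Cruxes.VoronoiHubFromSmirnov.MoebiusExactDelaunayDilationWard

open scoped ENNReal
open MeasureTheory ProbabilityTheory Set Literature.Analysis.FunctionSpaces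

/-- **Zipping two independent families on a product space** (general measurable targets). If
`(X i)ᵢ` is an independent family of random variables on `(Ω₁, μ₁)` and `(Y i)ᵢ` one on `(Ω₂, μ₂)`
(probability spaces), then the pairs `p ↦ (X i p.1, Y i p.2)` form an independent family on the
product space `(Ω₁ × Ω₂, μ₁ ⊗ μ₂)`: the rectangles `X i ⁻¹' A ×ˢ Y i ⁻¹' B` form a generating
π-system of `σ(p ↦ (X i p.1, Y i p.2))` (`generateFrom_prod`), and on rectangles
`(μ₁ ⊗ μ₂)(⋂ᵢ X i ⁻¹' Aᵢ ×ˢ Y i ⁻¹' Bᵢ) = μ₁(⋂ᵢ X i ⁻¹' Aᵢ) μ₂(⋂ᵢ Y i ⁻¹' Bᵢ)` factorises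
(`Measure.prod_prod`); `ProbabilityTheory.iIndepSets.iIndep` concludes. (The tree's
`iIndepFun_prodMk_prod` is the discrete-target case.) -/
theorem iIndepFun_prodMk_prod_of_measurable {Ω₁ Ω₂ ι : Type*} [MeasurableSpace Ω₁]
    [MeasurableSpace Ω₂] {β γ : ι → Type*} [∀ i, MeasurableSpace (β i)]
    [∀ i, MeasurableSpace (γ i)] {μ₁ : Measure Ω₁} {μ₂ : Measure Ω₂} [IsProbabilityMeasure μ₁]
    [IsProbabilityMeasure μ₂] {X : ∀ i, Ω₁ → β i} {Y : ∀ i, Ω₂ → γ i}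
    (hX : ∀ i, Measurable (X i)) (hY : ∀ i, Measurable (Y i)) (h₁ : iIndepFun X μ₁)
    (h₂ : iIndepFun Y μ₂) :
    iIndepFun (fun i (p : Ω₁ × Ω₂) => (X i p.1, Y i p.2)) (μ₁.prod μ₂) := by
  classical
  have hXY : ∀ i, Measurable fun p : Ω₁ × Ω₂ => (X i p.1, Y i p.2) := fun i =>
    ((hX i).comp measurable_fst).prodMk ((hY i).comp measurable_snd)
  rw [iIndepFun_iff_iIndep]
  refine iIndepSets.iIndep (fun i => (hXY i).comap_le)
    (fun i => {s : Set (Ω₁ × Ω₂) | ∃ (A : Set (β i)) (B : Set (γ i)),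
      MeasurableSet A ∧ MeasurableSet B ∧ s = (X i ⁻¹' A) ×ˢ (Y i ⁻¹' B)}) ?_ ?_ ?_
  · -- rectangles form a π-system
    rintro i _ ⟨A, B, hA, hB, rfl⟩ _ ⟨A', B', hA', hB', rfl⟩ -
    exact ⟨A ∩ A', B ∩ B', hA.inter hA', hB.inter hB', by rw [Set.prod_inter_prod]; rfl⟩
  · -- rectangles generate `σ(p ↦ (X i p.1, Y i p.2))`
    intro i
    rw [← generateFrom_prod, MeasurableSpace.comap_generateFrom]
    congr 1
    ext s
    simp only [Set.mem_image, Set.mem_image2, Set.mem_setOf_eq]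
    constructor
    · rintro ⟨_, ⟨A, hA, B, hB, rfl⟩, rfl⟩
      exact ⟨A, B, hA, hB, by ext p; simp⟩
    · rintro ⟨A, B, hA, hB, rfl⟩
      exact ⟨A ×ˢ B, ⟨A, hA, B, hB, rfl⟩, by ext p; simp⟩
  · -- the product formula on rectangles
    refine (iIndepSets_iff _ _).2 fun S f hf => ?_
    have hf' : ∀ i, ∃ (A : Set (β i)) (B : Set (γ i)), MeasurableSet A ∧ MeasurableSet B ∧
        (i ∈ S → f i = (X i ⁻¹' A) ×ˢ (Y i ⁻¹' B)) := fun i => by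
      by_cases hi : i ∈ S
      · obtain ⟨A, B, hA, hB, h⟩ := hf i hi
        exact ⟨A, B, hA, hB, fun _ => h⟩
      · exact ⟨univ, univ, MeasurableSet.univ, MeasurableSet.univ, fun hi' => absurd hi' hi⟩
    choose A B hA hB hfAB using hf'
    have h1 := h₁.measure_inter_preimage_eq_mul S (sets := A) fun i _ => hA i
    have h2 := h₂.measure_inter_preimage_eq_mul S (sets := B) fun i _ => hB i
    calc (μ₁.prod μ₂) (⋂ i ∈ S, f i)
        = (μ₁.prod μ₂) ((⋂ i ∈ S, X i ⁻¹' A i) ×ˢ (⋂ i ∈ S, Y i ⁻¹' B i)) := by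
          rw [Set.iInter₂_congr hfAB]
          congr 1
          ext p
          simp only [Set.mem_iInter, Set.mem_prod]
          exact ⟨fun h => ⟨fun i hi => (h i hi).1, fun i hi => (h i hi).2⟩,
            fun h i hi => ⟨h.1 i hi, h.2 i hi⟩⟩
      _ = ∏ i ∈ S, μ₁ (X i ⁻¹' A i) * μ₂ (Y i ⁻¹' B i) := by
          rw [Measure.prod_prod, h1, h2, Finset.prod_mul_distrib]
      _ = ∏ i ∈ S, (μ₁.prod μ₂) (f i) :=
          Finset.prod_congr rfl fun i hi => by rw [hfAB i hi, Measure.prod_prod]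

/-- **Product rule for events localised on disjoint regions under `lawBW μ`** (registered helper of
the crux). For a locally finite atomless intensity `μ` on `ℂ`, pairwise disjoint measurable regions
`D i`, `i : Fin n`, and measurable sets `A i` of coloured configurations, the events
`{c | (c.1 ∩ D i, c.2 ∩ D i) ∈ A i}` are mutually independent under the two-colour law
`lawBW μ = poissonLaw μ ⊗ poissonLaw μ`: Kingman's Restriction Theorem
(`IsPoissonPointProcess.iIndepFun_restrict`) on each factor, zipped over the product
(`iIndepFun_prodMk_prod_of_measurable`). -/
theorem lawBW_iInter_restrict_eq_prod : ∀ (μ : MeasureTheory.Measure ℂ) [MeasureTheory.IsLocallyFiniteMeasure μ], (∀ x : ℂ, μ {x} = 0) → ∀ (n : ℕ) (D : Fin n → Set ℂ), (∀ i, MeasurableSet (D i)) → Pairwise (Function.onFun Disjoint D) → ∀ (A : Fin n → Set (Literature.Analysis.FunctionSpaces.PointConfig ℂ × Literature.Analysis.FunctionSpaces.PointConfig ℂ)), (∀ i, MeasurableSet (A i)) → (lawBW μ) (⋂ i, {c | (Literature.Analysis.FunctionSpaces.PointConfig.restrict (D i) c.1, Literature.Analysis.FunctionSpaces.PointConfig.restrict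 (D i) c.2) ∈ A i}) = ∏ i, (lawBW μ) {c | (Literature.Analysis.FunctionSpaces.PointConfig.restrict (D i) c.1, Literature.Analysis.FunctionSpaces.PointConfig.restrict (D i) c.2) ∈ A i} := by
  intro μ _ hμ n D hD hdisj A hA
  have hP : IsPoissonPointProcess μ (poissonLaw μ) :=
    isPoissonPointProcess_poissonLaw_of_atomless μ hμ
  haveI : IsProbabilityMeasure (poissonLaw μ) := hP.isProbabilityMeasure
  have hind : iIndepFun (fun i => PointConfig.restrict (D i)) (poissonLaw μ) :=
    hP.iIndepFun_restrict hD hdisj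
  have hzip : iIndepFun (fun i (c : PointConfig ℂ × PointConfig ℂ) =>
      (PointConfig.restrict (D i) c.1, PointConfig.restrict (D i) c.2)) (lawBW μ) :=
    iIndepFun_prodMk_prod_of_measurable (fun i => PointConfig.measurable_restrict (hD i))
      (fun i => PointConfig.measurable_restrict (hD i)) hind hind
  have key := hzip.measure_inter_preimage_eq_mul Finset.univ (sets := A) fun i _ => hA i
  simp only [Finset.mem_univ, Set.iInter_true] at key
  exact key

end Summit.CriticalPhenomena.CardyFormulaZ2.Cruxes.VoronoiHubFromSmirnov.MoebiusExactDelaunayDilationWard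

end
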